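import Mathlib
import HarnessLib
import Summits.ResolutionOfSingularities.ResolutionOfSingularities.Theorems.WildQuotientsWildQuotientResolutionS1aJInf
import Summits.ResolutionOfSingularities.ResolutionOfSingularities.Theorems.WildQuotientsWildQuotientResolutionS1aFrameWins

/-!
# S1a — `WinningStrategy p` FROM THE RULE OF RECORD `KillOrAuxRuleJInf p` (the `Theses`-cone wrapper of `…S1aJInf`)

[OURS · L1 W4.5c · lead-1 g7; plan-1 CHAIN v10.6 / ASSIGNMENT v10.6 (2)] — NOT statements of the manuscript; counted 0; AI-level work,
weaker than expert review. Crux stmt-ResolutionOfSingularities-17941, line `s1a-logminvertex` v6, registered stub `stub_winningStrategy`.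

* **`winningStrategy_of_killOrAuxRuleJInf`** — `KillOrAuxRuleJInf p → S1.FrameWins.WinningStrategy p` (`p` prime): the registered stub is
  CLOSED MODULO plan-1ʼs residual OF RECORD, the two-phase rule with the aux measure `jInf` (dimension of the non-killable locus).
* `cyclicQuotientFourfolds_of_door_of_killOrAuxRuleJInf`.
-/

set_option linter.dupNamespace false

noncomputable section

open CategoryTheory Limits AlgebraicGeometry TopologicalSpace
open Literature.AlgebraicGeometry.Resolution Literature.AlgebraicGeometry.RelativeSpec
open Summit.ResolutionOfSingularities.ResolutionOfSingularities.Theorems.WildQuotientResolution.S1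
open Summit.ResolutionOfSingularities.ResolutionOfSingularities.Theorems.WildQuotientResolution.S1.GameFrame

namespace Summit.ResolutionOfSingularities.ResolutionOfSingularities.Theorems.WildQuotientResolution.S1

/-- **THE TERMINATION CRUX REDUCED TO THE RULE OF RECORD**: `KillOrAuxRuleJInf p → WinningStrategy p`. [OURS · L1 W4.5c] -/
theorem winningStrategy_of_killOrAuxRuleJInf {p : ℕ} (hp : p.Prime) (hrule : KillOrAuxRuleJInf p) :
    FrameWins.WinningStrategy p := by
  intro k _ _ _ X' X₁ f q G _ _ ρ _ _ hfft hfqc _ _ _ hqfin _ _ hq _ _ _ g₀ hg₀ _ h₀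
  haveI := hfft
  haveI := hfqc
  haveI := hqfin
  exact GModel.wins_initial_of_killOrAuxRuleJInf hp hrule f hg₀ hq h₀

/-- **Door + rule of record ⇒ the sub-crux `CyclicQuotientFourfolds`.** [OURS · L1 W4.5c] -/
theorem cyclicQuotientFourfolds_of_door_of_killOrAuxRuleJInf (hD : FrameWins.DoorStatement)
    (hrule : ∀ p : ℕ, p.Prime → KillOrAuxRuleJInf p) :
    Summit.ResolutionOfSingularities.ResolutionOfSingularities.Theses.WildQuotients.CyclicQuotientFourfolds :=
  FrameWins.cyclicQuotientFourfolds_of_door_of_wins hD fun p hp _ => winningStrategy_of_killOrAuxRuleJInf hp (hrule p hp)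

end Summit.ResolutionOfSingularities.ResolutionOfSingularities.Theorems.WildQuotientResolution.S1

end
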